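import Summits.ValiantsHypothesis.ValiantsHypothesis.Theorems.LacunarySymmetroidMatrixDescartesGraftFlagCertificate

/-!
# `MatrixDescartes` census — FLAG CERTIFICATE kit: trailing minors as `Fin`-indexed determinants, and a worked `(2,3) = 5` example

HONEST FRAMING.  Object-search cell `pub-symmetroid`, crux `Theses.LacunarySymmetroid.MatrixDescartes`
(stmt-ValiantsHypothesis-18050); seat val-sym-mdr-p1 (g3).  Census (CONJECTURE-A) currency only; nothing about the crux
`MatrixDescartes`, `DoorA26` / `DoorA34`, or `VP ≠ VNP`.  No definitions.

* `det_trailingMinor_eq` — the trailing principal minor appearing in the hypotheses of the seat's FLAG CERTIFICATE THEOREM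
  (`Graft.exists_flag_certificate` / `not_posRootLawAt_of_flag_certificate`: a determinant indexed by the subtype of the finset
  `{b : Fin m | b < a}ᶜ`) equals the determinant of the honest `Fin (m − a)`-indexed lower-right block `M[a.., a..]` — so a certificate
  generator can discharge those hypotheses with `Matrix.det_fin_two` / `det_fin_three` / `Census.det_fin_four` and `norm_num`.
* WORKED EXAMPLE (`flagDemo_certificate`: a `5`-alternation certificate at `(2,3)`, `5 = D(2,3)`; the row `¬ PosRootLawAt 2 3 4` is the tree's
  `Census.M2K3R11.not_posRootLawAt`): obtained here NOT from a 3-letter witness but from the 2-letter rational SOURCE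
  `F(x) = [[4 − x, 2], [2, x − 10]]` (determinant roots `7 ± √5 < 9.5`, entry `F₂₂` root `10 ∈ (9.5, 11)`) with thresholds `θ = (19/2, 11)`,
  six rational test points `4 < 7 < 47/5 < 39/4 < 21/2 < 12` in windows `0,0,0,1,1,2`, by `not_posRootLawAt_of_flag_certificate` — the template a
  census generator follows for CAP / flag-graft rows (source pencil small, lacunarity `D` symbolic).  [folklore]
-/

-- `Summit.ValiantsHypothesis.ValiantsHypothesis.…` repeats a component by the D-0017 layout
-- (single-conjunct summit), which the `dupNamespace` linter flags; the name is mandated.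
set_option linter.dupNamespace false

namespace Summit.ValiantsHypothesis.ValiantsHypothesis.Theorems.LacunarySymmetroidMatrixDescartes.Census.Graft

open Matrix Finset Filter Topology
open scoped BigOperators

/-- **Trailing minor in `Fin` coordinates.**  For `a ≤ m`, the determinant of `M` restricted to the coordinates `{b | ¬ b < a}` (the subtype
form used by the flag certificate theorem) is the determinant of the lower-right `(m − a) × (m − a)` block `i j ↦ M (a+i) (a+j)`. [folklore] -/
theorem det_trailingMinor_eq {m : ℕ} (M : Matrix (Fin m) (Fin m) ℝ) (a : ℕ) (ha : a ≤ m) :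
    (M.submatrix ((↑) : ↥((univ.filter (fun b : Fin m => (b : ℕ) < a))ᶜ) → Fin m)
        ((↑) : ↥((univ.filter (fun b : Fin m => (b : ℕ) < a))ᶜ) → Fin m)).det
      = (M.submatrix (fun i : Fin (m - a) => (⟨a + (i : ℕ), by omega⟩ : Fin m))
          (fun i : Fin (m - a) => (⟨a + (i : ℕ), by omega⟩ : Fin m))).det := by
  classical
  let e : Fin (m - a) ≃ ↥((univ.filter (fun b : Fin m => (b : ℕ) < a))ᶜ) :=
    { toFun := fun i => ⟨⟨a + (i : ℕ), by omega⟩, by simp [Finset.mem_filter]⟩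
      invFun := fun b => ⟨((b : Fin m) : ℕ) - a, by
        have hb := b.2
        simp only [Finset.mem_compl, Finset.mem_filter, Finset.mem_univ, true_and, not_lt] at hb
        have := (b : Fin m).isLt
        omega⟩
      left_inv := fun i => by
        ext
        simp
      right_inv := fun b => by
        have hb := b.2
        simp only [Finset.mem_compl, Finset.mem_filter, Finset.mem_univ, true_and, not_lt] at hb
        apply Subtype.ext
        apply Fin.ext
        simp only
        omega }
  rw [← Matrix.det_submatrix_equiv_self e, Matrix.submatrix_submatrix]
  rfl

open Summit.ValiantsHypothesis.ValiantsHypothesis.Theorems.MatrixDescartes.Negative (PosRootLawAt)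

/-! ### Worked example: `ζ_sym(2,3) ≥ 5` from a two-letter rational source by the flag certificate theorem -/

/-- The source letters `A = [[4, 2], [2, −10]]`, `B = [[−1, 0], [0, 1]]` (so `F(x) = A + x·B = [[4 − x, 2], [2, x − 10]]`). [folklore] -/
theorem flagDemo_source_isSymm (l : Fin 2) :
    ((![!![4, 2; 2, -10], !![-1, 0; 0, 1]] : Fin 2 → Matrix (Fin 2) (Fin 2) ℝ) l).IsSymm := by
  fin_cases l <;> (unfold Matrix.IsSymm; ext i j; fin_cases i <;> fin_cases j <;> rfl)

/-- Value of the source pencil at `t`: `[[4 − t, 2], [2, t − 10]]`. [folklore] -/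
theorem flagDemo_eval (t : ℝ) :
    ∑ l, t ^ (![0, 1] : Fin 2 → ℕ) l • ((![!![4, 2; 2, -10], !![-1, 0; 0, 1]] : Fin 2 → Matrix (Fin 2) (Fin 2) ℝ) l)
      = !![4 - t, 2; 2, t - 10] := by
  ext i j
  rw [Fin.sum_univ_two]
  fin_cases i <;> fin_cases j <;> simp <;> ring

/-- The trailing minors of the source value, as `Fin (2 − a)`-indexed determinants. [folklore] -/
theorem flagDemo_minor (t : ℝ) (a : ℕ) (ha : a ≤ 2) :
    ((∑ l, t ^ (![0, 1] : Fin 2 → ℕ) l • ((![!![4, 2; 2, -10], !![-1, 0; 0, 1]] : Fin 2 → Matrix (Fin 2) (Fin 2) ℝ) l)).submatrix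
        ((↑) : ↥((univ.filter (fun b : Fin 2 => (b : ℕ) < a))ᶜ) → Fin 2)
        ((↑) : ↥((univ.filter (fun b : Fin 2 => (b : ℕ) < a))ᶜ) → Fin 2)).det
      = ((!![4 - t, 2; 2, t - 10] : Matrix (Fin 2) (Fin 2) ℝ).submatrix
          (fun i : Fin (2 - a) => (⟨a + (i : ℕ), by omega⟩ : Fin 2))
          (fun i : Fin (2 - a) => (⟨a + (i : ℕ), by omega⟩ : Fin 2))).det := by
  rw [flagDemo_eval, det_trailingMinor_eq _ a ha]

/-- Window `0` (no coordinate ON): the minor is `det F(t) = (4 − t)(t − 10) − 4`. [folklore] -/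
theorem flagDemo_minor_zero (t : ℝ) :
    ((∑ l, t ^ (![0, 1] : Fin 2 → ℕ) l • ((![!![4, 2; 2, -10], !![-1, 0; 0, 1]] : Fin 2 → Matrix (Fin 2) (Fin 2) ℝ) l)).submatrix
        ((↑) : ↥((univ.filter (fun b : Fin 2 => (b : ℕ) < 0))ᶜ) → Fin 2)
        ((↑) : ↥((univ.filter (fun b : Fin 2 => (b : ℕ) < 0))ᶜ) → Fin 2)).det
      = (4 - t) * (t - 10) - 4 := by
  rw [flagDemo_minor t 0 (by norm_num)]
  show (((!![4 - t, 2; 2, t - 10] : Matrix (Fin 2) (Fin 2) ℝ).submatrix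
    (fun i : Fin 2 => (⟨0 + (i : ℕ), by omega⟩ : Fin 2)) (fun i : Fin 2 => (⟨0 + (i : ℕ), by omega⟩ : Fin 2))).det)
    = (4 - t) * (t - 10) - 4
  have h : (fun i : Fin 2 => (⟨0 + (i : ℕ), by omega⟩ : Fin 2)) = id := by
    funext i; exact Fin.ext (by simp)
  rw [h, Matrix.submatrix_id_id, Matrix.det_fin_two]
  simp
  ring

/-- Window `1` (coordinate `0` ON): the minor is the entry `F(t)₁₁ = t − 10`. [folklore] -/
theorem flagDemo_minor_one (t : ℝ) :
    ((∑ l, t ^ (![0, 1] : Fin 2 → ℕ) l • ((![!![4, 2; 2, -10], !![-1, 0; 0, 1]] : Fin 2 → Matrix (Fin 2) (Fin 2) ℝ) l)).submatrix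
        ((↑) : ↥((univ.filter (fun b : Fin 2 => (b : ℕ) < 1))ᶜ) → Fin 2)
        ((↑) : ↥((univ.filter (fun b : Fin 2 => (b : ℕ) < 1))ᶜ) → Fin 2)).det
      = t - 10 := by
  rw [flagDemo_minor t 1 (by norm_num)]
  show (((!![4 - t, 2; 2, t - 10] : Matrix (Fin 2) (Fin 2) ℝ).submatrix
    (fun i : Fin 1 => (⟨1 + (i : ℕ), by omega⟩ : Fin 2)) (fun i : Fin 1 => (⟨1 + (i : ℕ), by omega⟩ : Fin 2))).det)
    = t - 10
  rw [Matrix.det_fin_one, Matrix.submatrix_apply]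
  have h : ((⟨1 + ((0 : Fin 1) : ℕ), by omega⟩ : Fin 2)) = 1 := Fin.ext (by simp)
  rw [h]
  simp

/-- Window `2` (both coordinates ON): the empty minor is `1`. [folklore] -/
theorem flagDemo_minor_two (t : ℝ) :
    ((∑ l, t ^ (![0, 1] : Fin 2 → ℕ) l • ((![!![4, 2; 2, -10], !![-1, 0; 0, 1]] : Fin 2 → Matrix (Fin 2) (Fin 2) ℝ) l)).submatrix
        ((↑) : ↥((univ.filter (fun b : Fin 2 => (b : ℕ) < 2))ᶜ) → Fin 2)
        ((↑) : ↥((univ.filter (fun b : Fin 2 => (b : ℕ) < 2))ᶜ) → Fin 2)).det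
      = 1 := by
  rw [flagDemo_minor t 2 (by norm_num)]
  exact Matrix.det_fin_zero

/-- **A FLAG CERTIFICATE for `(2,3)` from the two-letter source** (template): with thresholds `(19/2, 11)` and the six test points
`4, 7, 47/5` (window 0: `det F` signs `−,+,−`), `39/4, 21/2` (window 1: entry `F₁₁` signs `−,+`), `12` (window 2: empty minor), the flag
certificate theorem yields a lacunarity `D > 1` and signs `σ` such that the THREE-letter pencil `F + X^D • diagonal (σ_b θ_b^{−D})` has nonzero
determinant of alternating sign along all six points (`5` alternations = `D(2,3)`; the row `¬ PosRootLawAt 2 3 4` itself is the tree's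
`Census.M2K3R11.not_posRootLawAt`, and follows from this by `Graft.not_posRootLawAt_of_alternating`). [folklore] -/
theorem flagDemo_certificate :
    ∃ (D : ℕ) (σ : Fin 2 → ℝ), (∀ l, (![0, 1] : Fin 2 → ℕ) l < D) ∧ (∀ b, σ b ≠ 0) ∧
      (∀ j, (∑ l, (![4, 7, 47 / 5, 39 / 4, 21 / 2, 12] : Fin 6 → ℝ) j ^ (Fin.snoc (![0, 1] : Fin 2 → ℕ) D : Fin 3 → ℕ) l •
        (Fin.snoc ((![!![4, 2; 2, -10], !![-1, 0; 0, 1]] : Fin 2 → Matrix (Fin 2) (Fin 2) ℝ))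
          (diagonal fun b => σ b * ((![19 / 2, 11] : Fin 2 → ℝ) b)⁻¹ ^ D) : Fin 3 → Matrix (Fin 2) (Fin 2) ℝ) l).det ≠ 0) ∧
      ∀ j : Fin 5,
        (∑ l, (![4, 7, 47 / 5, 39 / 4, 21 / 2, 12] : Fin 6 → ℝ) j.castSucc ^ (Fin.snoc (![0, 1] : Fin 2 → ℕ) D : Fin 3 → ℕ) l •
          (Fin.snoc ((![!![4, 2; 2, -10], !![-1, 0; 0, 1]] : Fin 2 → Matrix (Fin 2) (Fin 2) ℝ))
            (diagonal fun b => σ b * ((![19 / 2, 11] : Fin 2 → ℝ) b)⁻¹ ^ D) : Fin 3 → Matrix (Fin 2) (Fin 2) ℝ) l).det *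
        (∑ l, (![4, 7, 47 / 5, 39 / 4, 21 / 2, 12] : Fin 6 → ℝ) j.succ ^ (Fin.snoc (![0, 1] : Fin 2 → ℕ) D : Fin 3 → ℕ) l •
          (Fin.snoc ((![!![4, 2; 2, -10], !![-1, 0; 0, 1]] : Fin 2 → Matrix (Fin 2) (Fin 2) ℝ))
            (diagonal fun b => σ b * ((![19 / 2, 11] : Fin 2 → ℝ) b)⁻¹ ^ D) : Fin 3 → Matrix (Fin 2) (Fin 2) ℝ) l).det < 0 := by
  refine exists_flag_certificate (L := 5) (![0, 1] : Fin 2 → ℕ)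
    (![!![4, 2; 2, -10], !![-1, 0; 0, 1]] : Fin 2 → Matrix (Fin 2) (Fin 2) ℝ)
    (![19 / 2, 11] : Fin 2 → ℝ) (by intro b; fin_cases b <;> norm_num)
    (![4, 7, 47 / 5, 39 / 4, 21 / 2, 12] : Fin 6 → ℝ)
    (by
      refine Fin.strictMono_iff_lt_succ.2 fun j => ?_
      fin_cases j <;> simp only [Fin.castSucc_mk, Fin.succ_mk] <;> norm_num)
    (by intro j; fin_cases j <;> norm_num)
    (![0, 0, 0, 1, 1, 2] : Fin 6 → ℕ) (by intro j; fin_cases j <;> decide)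
    (by intro j b hb; fin_cases j <;> fin_cases b <;> simp_all <;> norm_num)
    (by intro j b hb; fin_cases j <;> fin_cases b <;> simp_all <;> norm_num)
    (by intro j; fin_cases j <;> decide)
    ?_ ?_
  · -- nonvanishing of the trailing minors at every test point
    intro j
    fin_cases j
    · exact (flagDemo_minor_zero 4).trans_ne (show ((4 : ℝ) - 4) * (4 - 10) - 4 ≠ 0 by norm_num)
    · exact (flagDemo_minor_zero 7).trans_ne (show ((4 : ℝ) - 7) * (7 - 10) - 4 ≠ 0 by norm_num)
    · exact (flagDemo_minor_zero (47 / 5)).trans_ne (show ((4 : ℝ) - 47 / 5) * (47 / 5 - 10) - 4 ≠ 0 by norm_num)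
    · exact (flagDemo_minor_one (39 / 4)).trans_ne (show (39 / 4 : ℝ) - 10 ≠ 0 by norm_num)
    · exact (flagDemo_minor_one (21 / 2)).trans_ne (show (21 / 2 : ℝ) - 10 ≠ 0 by norm_num)
    · exact (flagDemo_minor_two 12).trans_ne (show (1 : ℝ) ≠ 0 by norm_num)
  · -- same-window consecutive test points give the minor opposite signs
    intro j hj
    fin_cases j
    · have h := mul_neg_of_neg_of_pos (show ((4 : ℝ) - 4) * (4 - 10) - 4 < 0 by norm_num)
        (show (0 : ℝ) < ((4 : ℝ) - 7) * (7 - 10) - 4 by norm_num)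
      rw [← flagDemo_minor_zero 4, ← flagDemo_minor_zero 7] at h
      exact h
    · have h := mul_neg_of_pos_of_neg (show (0 : ℝ) < ((4 : ℝ) - 7) * (7 - 10) - 4 by norm_num)
        (show ((4 : ℝ) - 47 / 5) * (47 / 5 - 10) - 4 < 0 by norm_num)
      rw [← flagDemo_minor_zero 7, ← flagDemo_minor_zero (47 / 5)] at h
      exact h
    · exact absurd hj (by decide)
    · have h := mul_neg_of_neg_of_pos (show (39 / 4 : ℝ) - 10 < 0 by norm_num)
        (show (0 : ℝ) < (21 / 2 : ℝ) - 10 by norm_num)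
      rw [← flagDemo_minor_one (39 / 4), ← flagDemo_minor_one (21 / 2)] at h
      exact h
    · exact absurd hj (by decide)

end Summit.ValiantsHypothesis.ValiantsHypothesis.Theorems.LacunarySymmetroidMatrixDescartes.Census.Graft
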